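import Literature.NumberTheory.LFunctions.Zhang2022.DetectorShiftMomentsDD

/-!
# Zhang (2022), programme F-S3 (cell landau-siegel §E, E-102 head 1): the boundary sum-of-squares data of the
# entangled cone — the four MOMENT IDENTITIES of an anchored triple `(a; x, y)`

Y. Zhang, *Discrete mean estimates and the Landau–Siegel zero*, arXiv:2211.02515v1 [Zhang2022LandauSiegel] — an
unrefereed manuscript under adjudication. **WHAT THIS IS NOT: not a claim about Theorems 1–2 of arXiv:2211.02515, about
Landau–Siegel zeros, or about Parity; nothing here asserts any analytic claim of the manuscript. «The programme SEARCHES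
and TYPES; no claim about Landau–Siegel zeros, Theorems 1–2 of arXiv:2211.02515 or a repaired Margin232 until a kernel
theorem says so.»**

Context (cell desk note barrier/p2/R3a-ENTDBL-p2.md v2, ls-barrier-p2 g4): for an anchor `a` (`θ = πa/2`) and two palette
nodes `x, y`, the polar block `Det.FormDetPolarDD ![a,x,y] g h` of the entangled main term (`Det.entangledMain`,
`DetectorEntangledCone`) splits, after the three-moment collapse (`Det.formDetPolarDD_eq_collapse`) and one integration by
parts in the variable `u = (i/π)g + x·∫_y^1 g`, into a bulk form weighted by `Re m₀(a;x,y)` plus a BOUNDARY form in the jets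
`(g(0), ∫₀¹g)`, `(h(0), ∫₀¹h)`. The boundary form is `2π²θcotθ·Re m₀·ω_x(g)·conj ω_y(h) + (π³/(2 sin θ))·L_x(g)·conj L_y(h)`
— a Gram (sum-of-squares) shape — PROVIDED four scalar identities among the divided-difference moments
`m₀ = Det.ddM0`, `m_s = Det.ddMs`, `m_n = Det.ddMn` of the triple `![a,x,y]` hold. This file proves exactly those four
identities, for pairwise distinct nodes (`Det.dd2_of_ne`; the confluent cases follow by continuity elsewhere), as identities
of Laurent polynomials in `e^{iπa/2}, e^{iπx/2}, e^{iπy/2}`: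

* `sosKappa c = c·e^{iπc/2}`, `sosSigma a c = −[e^{iπ(a+c)/2} − (c e^{iπ(c−a)/2} − a e^{−iπ(c−a)/2})/(c−a)]` (the two
  jet coefficients of the boundary square);
* (iv) `momentSOS_gamma_gamma`: `xy(x+y)·Im m₀ − 2xy·Im m_s − i·xy(y−x)·Re m₀ − i(x·m_n − y·conj m_n)
   = 2 sin θ · sosKappa x · conj (sosKappa y)`;
* (ii) `momentSOS_omega_gamma`: `i·y(2 Im m_s − (a+x+y) Im m₀) − m_n + y(a+x−y)·Re m₀ = sosSigma a x · conj (sosKappa y)`;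
* (iii) `momentSOS_gamma_omega`: `−i·x(2 Im m_s − (a+x+y) Im m₀) − conj m_n + x(a+y−x)·Re m₀ = conj (sosSigma a y) · sosKappa x`;
* (i) `momentSOS_omega_omega`: `2 sin θ·[(a+x+y) Im m₀ − 2 Im m_s − i(y−x) Re m₀] = sosSigma a x · conj (sosSigma a y)
   + 2a·cos θ·Re m₀` (i.e. `π³(e₁J − 2 Im m_s) − iπ³(y−x)R = (π³/(2 sin θ))σ_xσ̄_y + 2π²θ cot θ·R`).

Pure algebra (no analysis, no numerics); standard axioms. The assembly into the block identity and the positivity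
consequence (E-102 head 1 given L-B′1 = `Det.re_ddM0_sum_nonneg`) are separate leaves.
-/

noncomputable section

open Complex Real

namespace Literature.NumberTheory.LFunctions.Zhang2022

namespace Det

open scoped ComplexConjugate

/-! ### Part 1 — the jet coefficients `κ`, `σ` and the unit exponentials -/

/-- `κ(c) = c·e^{iπc/2}` — the `∫₀¹g`-coefficient of the boundary square (cell note R3a-ENTDBL-p2 v2 §0).
[cite: Zhang2022LandauSiegel, Prop 7.1 p.44 with (8.11)–(8.23)] -/
def sosKappa (c : ℝ) : ℂ := (c : ℂ) * cexp (I * ((π * c / 2 : ℝ) : ℂ))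

/-- `σ(a,c) = −[e^{iπ(a+c)/2} − (c·e^{iπ(c−a)/2} − a·e^{−iπ(c−a)/2})/(c − a)]` — the `ω`-coefficient of the boundary
square (cell note R3a-ENTDBL-p2 v2 §0; removable singularity at `c = a`, not used here).
[cite: Zhang2022LandauSiegel, Prop 7.1 p.44 with (8.11)–(8.23)] -/
def sosSigma (a c : ℝ) : ℂ :=
  -(cexp (I * ((π * (a + c) / 2 : ℝ) : ℂ))
    - ((c : ℂ) * cexp (I * ((π * (c - a) / 2 : ℝ) : ℂ)) - (a : ℂ) * cexp (-(I * ((π * (c - a) / 2 : ℝ) : ℂ))))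
      / ((c - a : ℝ) : ℂ))

/-- The unit exponential `E(c) = e^{iπc/2}`. [cite: Zhang2022LandauSiegel, Prop 7.1 p.44 with (8.11)–(8.23)] -/
def halfExp (c : ℝ) : ℂ := cexp (I * ((π * c / 2 : ℝ) : ℂ))

/-- `E(c) ≠ 0`. [cite: Zhang2022LandauSiegel, Prop 7.1 p.44 with (8.11)–(8.23)] -/
theorem halfExp_ne_zero (c : ℝ) : halfExp c ≠ 0 := Complex.exp_ne_zero _

/-- `conj E(c) = E(c)⁻¹`. [cite: Zhang2022LandauSiegel, Prop 7.1 p.44 with (8.11)–(8.23)] -/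
theorem conj_halfExp (c : ℝ) : conj (halfExp c) = (halfExp c)⁻¹ := by
  rw [halfExp, ← Complex.exp_conj, ← Complex.exp_neg, map_mul, Complex.conj_I, Complex.conj_ofReal]
  ring_nf

/-- `sin(πc/2) = (E(c) − E(c)⁻¹)/(2i)`. [cite: Zhang2022LandauSiegel, Prop 7.1 p.44 with (8.11)–(8.23)] -/
theorem ofReal_sin_half (c : ℝ) : ((Real.sin (π * c / 2) : ℝ) : ℂ) = (halfExp c - (halfExp c)⁻¹) / (2 * I) := by
  rw [Complex.ofReal_sin, Complex.sin, halfExp, ← Complex.exp_neg]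
  have h1 : -((π * c / 2 : ℝ) : ℂ) * I = -(I * ((π * c / 2 : ℝ) : ℂ)) := by ring
  have h2 : ((π * c / 2 : ℝ) : ℂ) * I = I * ((π * c / 2 : ℝ) : ℂ) := by ring
  rw [h1, h2]
  field_simp
  ring_nf
  rw [Complex.I_sq]
  ring

/-- `cos(πc/2) = (E(c) + E(c)⁻¹)/2`. [cite: Zhang2022LandauSiegel, Prop 7.1 p.44 with (8.11)–(8.23)] -/
theorem ofReal_cos_half (c : ℝ) : ((Real.cos (π * c / 2) : ℝ) : ℂ) = (halfExp c + (halfExp c)⁻¹) / 2 := by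
  rw [Complex.ofReal_cos, Complex.cos, halfExp, ← Complex.exp_neg]
  have h1 : -((π * c / 2 : ℝ) : ℂ) * I = -(I * ((π * c / 2 : ℝ) : ℂ)) := by ring
  have h2 : ((π * c / 2 : ℝ) : ℂ) * I = I * ((π * c / 2 : ℝ) : ℂ) := by ring
  rw [h1, h2, add_comm]

/-- `κ(c) = c·E(c)`. [cite: Zhang2022LandauSiegel, Prop 7.1 p.44 with (8.11)–(8.23)] -/
theorem sosKappa_eq (c : ℝ) : sosKappa c = (c : ℂ) * halfExp c := rfl

/-- `conj κ(c) = c·E(c)⁻¹`. [cite: Zhang2022LandauSiegel, Prop 7.1 p.44 with (8.11)–(8.23)] -/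
theorem conj_sosKappa (c : ℝ) : conj (sosKappa c) = (c : ℂ) * (halfExp c)⁻¹ := by
  rw [sosKappa_eq, map_mul, Complex.conj_ofReal, conj_halfExp]

/-- `e^{iπ(a+c)/2} = E(a)E(c)`. [folklore] -/
private theorem cexp_sum_half (a c : ℝ) : cexp (I * ((π * (a + c) / 2 : ℝ) : ℂ)) = halfExp a * halfExp c := by
  rw [halfExp, halfExp, ← Complex.exp_add]; congr 1; push_cast; ring

/-- `e^{iπ(c−a)/2} = E(c)E(a)⁻¹`. [folklore] -/
private theorem cexp_diff_half (a c : ℝ) : cexp (I * ((π * (c - a) / 2 : ℝ) : ℂ)) = halfExp c * (halfExp a)⁻¹ := by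
  rw [halfExp, halfExp, ← Complex.exp_neg, ← Complex.exp_add]; congr 1; push_cast; ring

/-- `e^{−iπ(c−a)/2} = E(a)E(c)⁻¹`. [folklore] -/
private theorem cexp_neg_diff_half (a c : ℝ) :
    cexp (-(I * ((π * (c - a) / 2 : ℝ) : ℂ))) = halfExp a * (halfExp c)⁻¹ := by
  rw [halfExp, halfExp, ← Complex.exp_neg, ← Complex.exp_add]; congr 1; push_cast; ring

/-- `σ(a,c)` through the unit exponentials. [cite: Zhang2022LandauSiegel, Prop 7.1 p.44 with (8.11)–(8.23)] -/
theorem sosSigma_eq (a c : ℝ) : sosSigma a c =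
    -(halfExp a * halfExp c
      - ((c : ℂ) * (halfExp c * (halfExp a)⁻¹) - (a : ℂ) * (halfExp a * (halfExp c)⁻¹)) / ((c - a : ℝ) : ℂ)) := by
  rw [sosSigma, cexp_sum_half, cexp_diff_half, cexp_neg_diff_half]

/-- `conj σ(a,c)` through the unit exponentials. [cite: Zhang2022LandauSiegel, Prop 7.1 p.44 with (8.11)–(8.23)] -/
theorem conj_sosSigma (a c : ℝ) : conj (sosSigma a c) =
    -((halfExp a)⁻¹ * (halfExp c)⁻¹
      - ((c : ℂ) * ((halfExp c)⁻¹ * halfExp a) - (a : ℂ) * ((halfExp a)⁻¹ * halfExp c)) / ((c - a : ℝ) : ℂ)) := by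
  rw [sosSigma_eq]
  simp only [map_neg, map_sub, map_mul, map_div₀, map_inv₀, Complex.conj_ofReal, conj_halfExp, inv_inv]

/-! ### Part 2 — the three moments of a pairwise-distinct anchored triple through the unit exponentials -/

section Moments

variable {a x y : ℝ}

/-- `e^{iπ(B−a)} = E(x)E(y)E(a)⁻¹`, `B = (a+x+y)/2`. [folklore] -/
private theorem cexp_B_sub_a' (a x y : ℝ) :
    cexp (I * π * (((a + x + y) / 2 - a : ℝ) : ℂ)) = halfExp x * halfExp y * (halfExp a)⁻¹ := by
  rw [halfExp, halfExp, halfExp, ← Complex.exp_neg, ← Complex.exp_add, ← Complex.exp_add]; congr 1; push_cast; ring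

/-- `e^{iπ(B−x)} = E(a)E(y)E(x)⁻¹`. [folklore] -/
private theorem cexp_B_sub_x' (a x y : ℝ) :
    cexp (I * π * (((a + x + y) / 2 - x : ℝ) : ℂ)) = halfExp a * halfExp y * (halfExp x)⁻¹ := by
  rw [halfExp, halfExp, halfExp, ← Complex.exp_neg, ← Complex.exp_add, ← Complex.exp_add]; congr 1; push_cast; ring

/-- `e^{iπ(B−y)} = E(a)E(x)E(y)⁻¹`. [folklore] -/
private theorem cexp_B_sub_y' (a x y : ℝ) :
    cexp (I * π * (((a + x + y) / 2 - y : ℝ) : ℂ)) = halfExp a * halfExp x * (halfExp y)⁻¹ := by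
  rw [halfExp, halfExp, halfExp, ← Complex.exp_neg, ← Complex.exp_add, ← Complex.exp_add]; congr 1; push_cast; ring

/-- `m₀(a;x,y) = Det.ddM0 ![a,x,y]` at pairwise-distinct nodes, through `E(a), E(x), E(y)` (three-term residue sum
`Det.dd2_of_ne`). [cite: Zhang2022LandauSiegel, proof of Prop 7.1, (7.19)–(7.21)] -/
theorem ddM0_anchored_eq (hax : a ≠ x) (hay : a ≠ y) (hxy : x ≠ y) :
    ddM0 ![a, x, y] =
      (a : ℂ) * (halfExp x * halfExp y * (halfExp a)⁻¹) / (((x - a) * (y - a) : ℝ) : ℂ)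
        + (x : ℂ) * (halfExp a * halfExp y * (halfExp x)⁻¹) / (((a - x) * (y - x) : ℝ) : ℂ)
        + (y : ℂ) * (halfExp a * halfExp x * (halfExp y)⁻¹) / (((a - y) * (x - y) : ℝ) : ℂ) := by
  simp only [ddM0, ddOf, shiftB, Matrix.cons_val_zero, Matrix.cons_val_one, Matrix.cons_val_two, Matrix.head_cons,
    Matrix.tail_cons]
  rw [dd2_of_ne _ _ _ hax hxy hay]
  simp only [ddBase, pow_one]
  rw [cexp_B_sub_a', cexp_B_sub_x', cexp_B_sub_y']

/-- `m_b(a;x,y) = Det.ddMb ![a,x,y]` at pairwise-distinct nodes, through the unit exponentials.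
[cite: Zhang2022LandauSiegel, §8 (8.13)–(8.18)] -/
theorem ddMb_anchored_eq (hax : a ≠ x) (hay : a ≠ y) (hxy : x ≠ y) :
    ddMb ![a, x, y] =
      (a : ℂ) ^ 2 * (halfExp x * halfExp y * (halfExp a)⁻¹) / (((x - a) * (y - a) : ℝ) : ℂ)
        + (x : ℂ) ^ 2 * (halfExp a * halfExp y * (halfExp x)⁻¹) / (((a - x) * (y - x) : ℝ) : ℂ)
        + (y : ℂ) ^ 2 * (halfExp a * halfExp x * (halfExp y)⁻¹) / (((a - y) * (x - y) : ℝ) : ℂ) := by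
  simp only [ddMb, ddOf, shiftB, Matrix.cons_val_zero, Matrix.cons_val_one, Matrix.cons_val_two, Matrix.head_cons,
    Matrix.tail_cons]
  rw [dd2_of_ne _ _ _ hax hxy hay]
  simp only [ddBase]
  rw [cexp_B_sub_a', cexp_B_sub_x', cexp_B_sub_y']

/-- `m_n(a;x,y) = Det.ddMn ![a,x,y] = axy·g_B[a,x,y]` at pairwise-distinct nodes, through the unit exponentials.
[cite: Zhang2022LandauSiegel, §8 (8.13)–(8.18)] -/
theorem ddMn_anchored_eq (hax : a ≠ x) (hay : a ≠ y) (hxy : x ≠ y) :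
    ddMn ![a, x, y] = ((a * x * y : ℝ) : ℂ) *
      ((halfExp x * halfExp y * (halfExp a)⁻¹) / (((x - a) * (y - a) : ℝ) : ℂ)
        + (halfExp a * halfExp y * (halfExp x)⁻¹) / (((a - x) * (y - x) : ℝ) : ℂ)
        + (halfExp a * halfExp x * (halfExp y)⁻¹) / (((a - y) * (x - y) : ℝ) : ℂ)) := by
  simp only [ddMn, ddOf, shiftB, Matrix.cons_val_zero, Matrix.cons_val_one, Matrix.cons_val_two, Matrix.head_cons,
    Matrix.tail_cons]
  rw [dd2_of_ne _ _ _ hax hxy hay]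
  simp only [ddBase, pow_zero, one_mul]
  rw [cexp_B_sub_a', cexp_B_sub_x', cexp_B_sub_y']

/-- `m_s = (a+x+y)·m₀ − m_b` (definitional `2B·m₀ − m_b`). [cite: Zhang2022LandauSiegel, §8 (8.13)–(8.18)] -/
theorem ddMs_anchored_eq (a x y : ℝ) :
    ddMs ![a, x, y] = ((a + x + y : ℝ) : ℂ) * ddM0 ![a, x, y] - ddMb ![a, x, y] := by
  simp only [ddMs, shiftB, Matrix.cons_val_zero, Matrix.cons_val_one, Matrix.cons_val_two, Matrix.head_cons,
    Matrix.tail_cons]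
  push_cast
  ring

end Moments

/-! ### Part 3 — the four moment identities (conjugate form: `2i·Im z = z − conj z`, `2·Re z = z + conj z`,
`2i·sin θ = E(a) − E(a)⁻¹`, `2·cos θ = E(a) + E(a)⁻¹`) -/

section Identities

variable {a x y : ℝ}

/-- Non-vanishing of the six node differences (as complex numbers). [folklore] -/
private theorem diffs_ne_zero (hax : a ≠ x) (hay : a ≠ y) (hxy : x ≠ y) :
    (x : ℂ) - a ≠ 0 ∧ (y : ℂ) - a ≠ 0 ∧ (a : ℂ) - x ≠ 0 ∧ (y : ℂ) - x ≠ 0 ∧ (a : ℂ) - y ≠ 0 ∧ (x : ℂ) - y ≠ 0 := by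
  refine ⟨?_, ?_, ?_, ?_, ?_, ?_⟩ <;> rw [sub_ne_zero] <;> norm_cast <;> tauto

/-- **(iv) the `γγ̄` identity**: `xy(x+y)(m₀ − m̄₀) − 2xy(m_s − m̄_s) + xy(y−x)(m₀ + m̄₀) + 2(x·m_n − y·m̄_n)
= 2(E(a) − E(a)⁻¹)·κ(x)·conj κ(y)`, i.e. `xy(x+y)Im m₀ − 2xy Im m_s − i xy(y−x)Re m₀ − i(x m_n − y m̄_n) = 2 sin θ·κ(x)κ̄(y)`
(cell note R3a-ENTDBL-p2 v2 §1 (iv)). [cite: Zhang2022LandauSiegel, Prop 7.1 p.44 with (8.11)–(8.23)] -/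
theorem momentSOS_gamma_gamma (hax : a ≠ x) (hay : a ≠ y) (hxy : x ≠ y) :
    ((x * y * (x + y) : ℝ) : ℂ) * (ddM0 ![a, x, y] - conj (ddM0 ![a, x, y]))
      - 2 * ((x * y : ℝ) : ℂ) * (ddMs ![a, x, y] - conj (ddMs ![a, x, y]))
      + ((x * y * (y - x) : ℝ) : ℂ) * (ddM0 ![a, x, y] + conj (ddM0 ![a, x, y]))
      + 2 * ((x : ℂ) * ddMn ![a, x, y] - (y : ℂ) * conj (ddMn ![a, x, y]))
    = 2 * (halfExp a - (halfExp a)⁻¹) * sosKappa x * conj (sosKappa y) := by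
  obtain ⟨d1, d2, d3, d4, d5, d6⟩ := diffs_ne_zero hax hay hxy
  have ha := halfExp_ne_zero a; have hx := halfExp_ne_zero x; have hy := halfExp_ne_zero y
  rw [ddMs_anchored_eq, ddM0_anchored_eq hax hay hxy, ddMb_anchored_eq hax hay hxy, ddMn_anchored_eq hax hay hxy,
    sosKappa_eq, conj_sosKappa]
  simp only [map_add, map_sub, map_mul, map_div₀, map_inv₀, map_pow, Complex.conj_ofReal, conj_halfExp, inv_inv]
  push_cast
  field_simp
  ring

/-- **(ii) the `ωγ̄` identity**: `2y(m_s − m̄_s) − y(a+x+y)(m₀ − m̄₀) − 2m_n + y(a+x−y)(m₀ + m̄₀) = 2σ(a,x)·conj κ(y)`,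
i.e. `i y(2 Im m_s − (a+x+y) Im m₀) − m_n + y(a+x−y) Re m₀ = σ(a,x)κ̄(y)` (cell note R3a-ENTDBL-p2 v2 §1 (ii)).
[cite: Zhang2022LandauSiegel, Prop 7.1 p.44 with (8.11)–(8.23)] -/
theorem momentSOS_omega_gamma (hax : a ≠ x) (hay : a ≠ y) (hxy : x ≠ y) :
    2 * (y : ℂ) * (ddMs ![a, x, y] - conj (ddMs ![a, x, y]))
      - ((y * (a + x + y) : ℝ) : ℂ) * (ddM0 ![a, x, y] - conj (ddM0 ![a, x, y]))
      - 2 * ddMn ![a, x, y]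
      + ((y * (a + x - y) : ℝ) : ℂ) * (ddM0 ![a, x, y] + conj (ddM0 ![a, x, y]))
    = 2 * sosSigma a x * conj (sosKappa y) := by
  obtain ⟨d1, d2, d3, d4, d5, d6⟩ := diffs_ne_zero hax hay hxy
  have ha := halfExp_ne_zero a; have hx := halfExp_ne_zero x; have hy := halfExp_ne_zero y
  rw [ddMs_anchored_eq, ddM0_anchored_eq hax hay hxy, ddMb_anchored_eq hax hay hxy, ddMn_anchored_eq hax hay hxy,
    sosSigma_eq, conj_sosKappa]
  simp only [map_add, map_sub, map_mul, map_div₀, map_inv₀, map_pow, Complex.conj_ofReal, conj_halfExp, inv_inv]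
  push_cast
  field_simp
  ring

/-- **(iii) the `γω̄` identity**: `−2x(m_s − m̄_s) + x(a+x+y)(m₀ − m̄₀) − 2m̄_n + x(a+y−x)(m₀ + m̄₀) = 2·conj σ(a,y)·κ(x)`,
i.e. `−i x(2 Im m_s − (a+x+y) Im m₀) − m̄_n + x(a+y−x) Re m₀ = σ̄(a,y)κ(x)` (cell note R3a-ENTDBL-p2 v2 §1 (iii)).
[cite: Zhang2022LandauSiegel, Prop 7.1 p.44 with (8.11)–(8.23)] -/
theorem momentSOS_gamma_omega (hax : a ≠ x) (hay : a ≠ y) (hxy : x ≠ y) :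
    -(2 * (x : ℂ)) * (ddMs ![a, x, y] - conj (ddMs ![a, x, y]))
      + ((x * (a + x + y) : ℝ) : ℂ) * (ddM0 ![a, x, y] - conj (ddM0 ![a, x, y]))
      - 2 * conj (ddMn ![a, x, y])
      + ((x * (a + y - x) : ℝ) : ℂ) * (ddM0 ![a, x, y] + conj (ddM0 ![a, x, y]))
    = 2 * conj (sosSigma a y) * sosKappa x := by
  obtain ⟨d1, d2, d3, d4, d5, d6⟩ := diffs_ne_zero hax hay hxy
  have ha := halfExp_ne_zero a; have hx := halfExp_ne_zero x; have hy := halfExp_ne_zero y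
  rw [ddMs_anchored_eq, ddM0_anchored_eq hax hay hxy, ddMb_anchored_eq hax hay hxy, ddMn_anchored_eq hax hay hxy,
    conj_sosSigma, sosKappa_eq]
  simp only [map_add, map_sub, map_mul, map_div₀, map_inv₀, map_pow, Complex.conj_ofReal, conj_halfExp, inv_inv]
  push_cast
  field_simp
  ring

/-- **(i) the `ωω̄` identity**: `(E(a) − E(a)⁻¹)·[−(a+x+y)(m₀ − m̄₀) + 2(m_s − m̄_s) − (y−x)(m₀ + m̄₀)]
= 2σ(a,x)·conj σ(a,y) + a(E(a) + E(a)⁻¹)(m₀ + m̄₀)`, i.e.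
`2 sin θ·[(a+x+y) Im m₀ − 2 Im m_s − i(y−x) Re m₀] = σ(a,x)σ̄(a,y) + 2a cos θ·Re m₀` with `θ = πa/2` — equivalently
`π³((a+x+y)Im m₀ − 2 Im m_s) − iπ³(y−x)Re m₀ = (π³/(2 sin θ))σ(a,x)σ̄(a,y) + 2π²θ cot θ·Re m₀` (cell note R3a-ENTDBL-p2 v2 §1 (i)).
[cite: Zhang2022LandauSiegel, Prop 7.1 p.44 with (8.11)–(8.23)] -/
theorem momentSOS_omega_omega (hax : a ≠ x) (hay : a ≠ y) (hxy : x ≠ y) :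
    (halfExp a - (halfExp a)⁻¹) *
        (-((a + x + y : ℝ) : ℂ) * (ddM0 ![a, x, y] - conj (ddM0 ![a, x, y]))
          + 2 * (ddMs ![a, x, y] - conj (ddMs ![a, x, y]))
          - ((y - x : ℝ) : ℂ) * (ddM0 ![a, x, y] + conj (ddM0 ![a, x, y])))
    = 2 * sosSigma a x * conj (sosSigma a y)
      + (a : ℂ) * (halfExp a + (halfExp a)⁻¹) * (ddM0 ![a, x, y] + conj (ddM0 ![a, x, y])) := by
  obtain ⟨d1, d2, d3, d4, d5, d6⟩ := diffs_ne_zero hax hay hxy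
  have ha := halfExp_ne_zero a; have hx := halfExp_ne_zero x; have hy := halfExp_ne_zero y
  rw [ddMs_anchored_eq, ddM0_anchored_eq hax hay hxy, ddMb_anchored_eq hax hay hxy, sosSigma_eq, conj_sosSigma]
  simp only [map_add, map_sub, map_mul, map_div₀, map_inv₀, map_pow, Complex.conj_ofReal, conj_halfExp, inv_inv]
  push_cast
  field_simp
  ring

/-- `E(0) = 1`. [cite: Zhang2022LandauSiegel, Prop 7.1 p.44 with (8.11)–(8.23)] -/
theorem halfExp_zero : halfExp 0 = 1 := by simp [halfExp]

/-- The ZERO NODE drops out of the boundary square: `κ(0) = 0`. [cite: Zhang2022LandauSiegel, Prop 7.1 p.44 with (8.11)–(8.23)] -/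
theorem sosKappa_zero : sosKappa 0 = 0 := by simp [sosKappa]

/-- The ZERO NODE drops out of the boundary square: `σ(a,0) = 0` (for `a ≠ 0`). [cite: Zhang2022LandauSiegel, Prop 7.1 p.44 with (8.11)–(8.23)] -/
theorem sosSigma_zero (ha : a ≠ 0) : sosSigma a 0 = 0 := by
  have ha' : (a : ℂ) ≠ 0 := by exact_mod_cast ha
  have hE := halfExp_ne_zero a
  rw [sosSigma_eq, halfExp_zero]
  push_cast
  field_simp
  ring

end Identities

end Det

end Literature.NumberTheory.LFunctions.Zhang2022
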